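import Literature.Barriers.CriticalPhenomena.GridSAWGridFormulaGraphExplicit
import Literature.Barriers.CriticalPhenomena.GridSAWGridFormulaGadgetsFP
import Literature.Computability.Complexity.CodeFPFinite
import Literature.Computability.Complexity.CodeFPListKit
import Literature.Computability.Complexity.CodeFPLists
import HarnessLib

/-!
# The vertex, slot and edge lists of the grid graph of a formula are typed polynomial time

Machine half of `GridSAW.LOT2003_lemma4_gadgets` (Liśkiewicz–Ogihara–Toda 2003, Lemma 4: "It is
not hard to see that `R` is polynomial-time computable"), continued: the explicit lists of
`GridSAWGridFormulaGraphExplicit.lean` — `chainVertsN`, `chainEdgesN`, `placeVerts`,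
`placeSlots`, `placeEdges`, `vertsListOf`, `slotsOf`, `edgesOf` — are computed in the `CodeFP`
algebra from the code `cnfC` of `ψ`, through numeric mirrors driven by the cell-type numbers
`cellTyN` (`GridSAWGridFormulaCellsFP.lean`) and the gadget tuples `gadN'`
(`GridSAWGridFormulaGadgetsFP.lean`):

* `vertValsN`, `edgeValsN`, `pValN`, `qValN` (cell tables by type number) and
  **`codeFP_chainVertsN`**, **`codeFP_chainEdgesN`**;
* `codeFP_railEdgesN`, `xorEdgesL`/`or1EdgesL`/`or3EdgesL` (= `xorEdgesN`, …),
  `specOKN`, `placeVertsN`, `placeSlotsN`, `placeEdgesN` (= `placeVerts`, …) and their codes;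
* **`codeFP_vertsListOf`**, **`codeFP_slotsOf`**, **`codeFP_edgesOf`**.

## References

* M. Liśkiewicz, M. Ogihara, S. Toda, TCS 304 (2003) 129–156, §3 (proof of Lemma 4).
* S. Arora, B. Barak, *Computational Complexity: A Modern Approach*, CUP 2009, §1.3.
-/

namespace Literature.Barriers.CriticalPhenomena.GridSAW

namespace GridFormulaFP

open _root_.Computability Polynomial Literature.Computability.Complexity Literature.Computability.Complexity.CodeFP
open Literature.Combinatorics.SimpleGraph Literature.Combinatorics.SimpleGraph.GridFormula
open Literature.Combinatorics.SimpleGraph.GridFormula.Slot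
open Literature.Combinatorics.SimpleGraph.GridCell (CellTy conn vtx)

/-- The code of a pair of numbers. -/
local notation "n2E" => pairE natE natE

/-- The code of pairs of numbers is injective. [folklore] -/
theorem n2E_injective : Function.Injective (pairE natE natE) := pairE_injective natE_injective natE_injective

/-! ### Cell tables by type number -/

/-- The local vertices of a cell type, by type number. [folklore] -/
def vertValsN (n : ℕ) : List ℕ :=
  if n = 0 then CellTy.bead.vertList.map Fin.val else if n = 1 then CellTy.pc.vertList.map Fin.val else CellTy.pct.vertList.map Fin.val

/-- The local edges of a cell type, by type number. [folklore] -/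
def edgeValsN (n : ℕ) : List (ℕ × ℕ) :=
  if n = 0 then CellTy.bead.edgeList.map (fun e => (e.1.val, e.2.val))
  else if n = 1 then CellTy.pc.edgeList.map (fun e => (e.1.val, e.2.val)) else CellTy.pct.edgeList.map (fun e => (e.1.val, e.2.val))

/-- The entry corner, by type number. [folklore] -/
def pValN (n : ℕ) : ℕ := if n = 2 then 12 else 0

/-- The exit corner, by type number. [folklore] -/
def qValN (n : ℕ) : ℕ := if n = 2 then 15 else 3

/-- The tables agree with the cell type. [folklore] -/
theorem tables_cellTyN (ty : CellTy) :
    vertValsN (cellTyN ty) = ty.vertList.map Fin.val ∧ edgeValsN (cellTyN ty) = ty.edgeList.map (fun e => (e.1.val, e.2.val)) ∧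
      pValN (cellTyN ty) = ty.pIdx.val ∧ qValN (cellTyN ty) = ty.qIdx.val := by
  cases ty <;> simp [vertValsN, edgeValsN, pValN, qValN, cellTyN, CellTy.pIdx, CellTy.qIdx]

/-- The vertex table is typed polynomial time. [cite: AroraBarak2009, §1.3] -/
theorem codeFP_vertValsN : CodeFP natE (rawE natE) vertValsN :=
  ((natEq.comp ((CodeFP.id natE).pair (const _ 0))).ite (const _ (CellTy.bead.vertList.map Fin.val))
    ((natEq.comp ((CodeFP.id natE).pair (const _ 1))).ite (const _ (CellTy.pc.vertList.map Fin.val))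
      (const _ (CellTy.pct.vertList.map Fin.val)))).congr fun n => by simp [vertValsN]

/-- The edge table is typed polynomial time. [cite: AroraBarak2009, §1.3] -/
theorem codeFP_edgeValsN : CodeFP natE (rawE n2E) edgeValsN :=
  ((natEq.comp ((CodeFP.id natE).pair (const _ 0))).ite (const _ (CellTy.bead.edgeList.map (fun e => (e.1.val, e.2.val))))
    ((natEq.comp ((CodeFP.id natE).pair (const _ 1))).ite (const _ (CellTy.pc.edgeList.map (fun e => (e.1.val, e.2.val))))
      (const _ (CellTy.pct.edgeList.map (fun e => (e.1.val, e.2.val)))))).congr fun n => by simp [edgeValsN]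

/-- The entry corner table is typed polynomial time. [cite: AroraBarak2009, §1.3] -/
theorem codeFP_pValN : CodeFP natE natE pValN :=
  ((natEq.comp ((CodeFP.id natE).pair (const _ 2))).ite (const _ 12) (const _ 0)).congr fun n => by simp [pValN]

/-- The exit corner table is typed polynomial time. [cite: AroraBarak2009, §1.3] -/
theorem codeFP_qValN : CodeFP natE natE qValN :=
  ((natEq.comp ((CodeFP.id natE).pair (const _ 2))).ite (const _ 15) (const _ 3)).congr fun n => by simp [qValN]

/-! ### The chain lists -/

section Chain

/-- Context `(ψ, kc)`. -/
local notation "E2" => pairE cnfC natE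

/-- The type number of cell `kc`, in context. [cite: AroraBarak2009, §1.3] -/
theorem codeFP_tyN : CodeFP E2 natE (fun p => cellTyN (cellTyAt p.1 p.2)) := codeFP_cellTyN

/-- `17 kc`. [cite: AroraBarak2009, §1.3] -/
theorem codeFP_connN : CodeFP E2 natE (fun p => 17 * p.2) := natMul.comp ((const _ 17).pair (snd _ _))

/-- `17 kc + 1`. [cite: AroraBarak2009, §1.3] -/
theorem codeFP_vtx0 : CodeFP E2 natE (fun p => 17 * p.2 + 1) := natAdd.comp (codeFP_connN.pair (const _ 1))

/-- **The block of cell `kc`** `conn kc :: vertList.map (vtx kc)`, numerically. [cite: AroraBarak2009, §1.3] -/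
theorem codeFP_chainBlockV :
    CodeFP E2 (rawE natE) (fun p => 17 * p.2 :: (vertValsN (cellTyN (cellTyAt p.1 p.2))).map fun a => 17 * p.2 + 1 + a) := by
  have hm := map (σ := CNF ℕ × ℕ) (eσ := E2) (α := ℕ) (eα := natE) (g := fun q => 17 * q.1.2 + 1 + q.2)
    (natAdd.comp ((codeFP_vtx0.comp (fst _ _)).pair (snd _ _)))
  have hl : CodeFP E2 (rawE natE) (fun p => (vertValsN (cellTyN (cellTyAt p.1 p.2))).map fun a => 17 * p.2 + 1 + a) :=
    (hm.comp ((CodeFP.id E2).pair (codeFP_vertValsN.comp codeFP_tyN))).congr fun _ => rfl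
  exact (rawCons natE).comp (codeFP_connN.pair hl)

/-- The chain's vertex list, numerically. [folklore] -/
theorem chainVertsN_eq (ψ : CNF ℕ) : chainVertsN ψ =
    ((List.range (ncells ψ)).map fun kc => 17 * kc :: (vertValsN (cellTyN (cellTyAt ψ kc))).map fun a => 17 * kc + 1 + a).flatten := by
  unfold chainVertsN
  rw [List.flatMap_def]
  refine congrArg _ (List.map_congr_left fun kc _ => ?_)
  rw [(tables_cellTyN _).1, List.map_map]
  rfl

/-- **The chain's vertex list is typed polynomial time.** [cite: AroraBarak2009, §1.3] -/
theorem codeFP_chainVertsN : CodeFP cnfC (rawE natE) chainVertsN := by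
  have hr : CodeFP cnfC (rawE natE) (fun ψ => List.range (ncells ψ)) := (urange.comp codeFP_uncells).congr fun _ => rfl
  have hm := (map (σ := CNF ℕ) (eσ := cnfC) codeFP_chainBlockV).comp ((CodeFP.id cnfC).pair hr)
  exact ((flatten natE).comp hm).congr fun ψ => (chainVertsN_eq ψ).symm

/-- The cell edges of cell `kc`, numerically. [cite: AroraBarak2009, §1.3] -/
theorem codeFP_cellEdgePairs :
    CodeFP E2 (rawE n2E) (fun p => (edgeValsN (cellTyN (cellTyAt p.1 p.2))).map fun ab => (17 * p.2 + 1 + ab.1, 17 * p.2 + 1 + ab.2)) := by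
  have hb : CodeFP (pairE E2 n2E) natE (fun q => 17 * q.1.2 + 1) := codeFP_vtx0.comp (fst _ _)
  have hg : CodeFP (pairE E2 n2E) n2E (fun q => (17 * q.1.2 + 1 + q.2.1, 17 * q.1.2 + 1 + q.2.2)) :=
    (natAdd.comp (hb.pair (snd _ _).fst')).pair (natAdd.comp (hb.pair (snd _ _).snd'))
  have hm : CodeFP (pairE E2 (rawE n2E)) (rawE n2E) (fun q => q.2.map fun ab => (17 * q.1.2 + 1 + ab.1, 17 * q.1.2 + 1 + ab.2)) := map hg
  exact (hm.comp ((CodeFP.id E2).pair (codeFP_edgeValsN.comp codeFP_tyN))).congr fun _ => rfl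

/-- The exit edge of cell `kc` (absent at the last cell), numerically. [cite: AroraBarak2009, §1.3] -/
theorem codeFP_exitEdge :
    CodeFP E2 (rawE n2E) (fun p => if decide (p.2 + 1 < ncells p.1) then
      [(17 * p.2 + 1 + qValN (cellTyN (cellTyAt p.1 p.2)), 17 * (p.2 + 1))] else []) := by
  have htest : CodeFP E2 bitE (fun p => decide (p.2 + 1 < ncells p.1)) :=
    natLt.comp ((natAdd.comp ((snd _ _).pair (const _ 1))).pair (codeFP_ncells.comp (fst _ _)))
  have h2 : CodeFP E2 (rawE n2E) (fun p => [(17 * p.2 + 1 + qValN (cellTyN (cellTyAt p.1 p.2)), 17 * (p.2 + 1))]) :=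
    (rawSingleton n2E).comp ((natAdd.comp (codeFP_vtx0.pair (codeFP_qValN.comp codeFP_tyN))).pair
      (natMul.comp ((const _ 17).pair (natAdd.comp ((snd _ _).pair (const _ 1))))))
  exact htest.ite h2 (const _ [])

/-- **The edges of cell `kc`** (entry edge, cell edges, exit edge), numerically. [cite: AroraBarak2009, §1.3] -/
theorem codeFP_chainBlockE :
    CodeFP E2 (rawE n2E) (fun p => (17 * p.2, 17 * p.2 + 1 + pValN (cellTyN (cellTyAt p.1 p.2))) ::
      (((edgeValsN (cellTyN (cellTyAt p.1 p.2))).map fun ab => (17 * p.2 + 1 + ab.1, 17 * p.2 + 1 + ab.2)) ++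
      (if decide (p.2 + 1 < ncells p.1) then [(17 * p.2 + 1 + qValN (cellTyN (cellTyAt p.1 p.2)), 17 * (p.2 + 1))] else []))) := by
  have h0 : CodeFP E2 n2E (fun p => (17 * p.2, 17 * p.2 + 1 + pValN (cellTyN (cellTyAt p.1 p.2)))) :=
    codeFP_connN.pair (natAdd.comp (codeFP_vtx0.pair (codeFP_pValN.comp codeFP_tyN)))
  have h1 := (rawAppend n2E).comp (codeFP_cellEdgePairs.pair codeFP_exitEdge)
  have h := (rawCons n2E).comp (h0.pair h1)
  exact h.congr fun _ => rfl

/-- The chain's edge list, numerically. [folklore] -/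
theorem chainEdgesN_eq (ψ : CNF ℕ) : chainEdgesN ψ =
    ((List.range (ncells ψ)).map fun kc =>
      (17 * kc, 17 * kc + 1 + pValN (cellTyN (cellTyAt ψ kc))) ::
        (((edgeValsN (cellTyN (cellTyAt ψ kc))).map fun ab => (17 * kc + 1 + ab.1, 17 * kc + 1 + ab.2)) ++
          (if decide (kc + 1 < ncells ψ) then [(17 * kc + 1 + qValN (cellTyN (cellTyAt ψ kc)), 17 * (kc + 1))] else []))).flatten := by
  unfold chainEdgesN
  rw [List.flatMap_def]
  refine congrArg _ (List.map_congr_left fun kc _ => ?_)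
  obtain ⟨-, he, hp, hq⟩ := tables_cellTyN (cellTyAt ψ kc)
  rw [he, hp, hq, List.map_map]
  unfold cellEdgesN
  simp only [GridCell.conn, GridCell.vtx, decide_eq_true_eq, Function.comp_def, List.cons_append]

/-- **The chain's edge list is typed polynomial time.** [cite: AroraBarak2009, §1.3] -/
theorem codeFP_chainEdgesN : CodeFP cnfC (rawE n2E) chainEdgesN := by
  have hr : CodeFP cnfC (rawE natE) (fun ψ => List.range (ncells ψ)) := (urange.comp codeFP_uncells).congr fun _ => rfl
  have hm := (map (σ := CNF ℕ) (eσ := cnfC) codeFP_chainBlockE).comp ((CodeFP.id cnfC).pair hr)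
  exact ((flatten n2E).comp hm).congr fun ψ => (chainEdgesN_eq ψ).symm

end Chain

/-! ### Rail gadgets, numerically -/

section Rails

/-- **The edges of one rail are typed polynomial time** (`K`, `r` fixed; context `(base, u, v)`). [cite: AroraBarak2009, §1.3] -/
theorem codeFP_railEdgesN (K r : ℕ) : CodeFP (pairE natE n2E) (rawE n2E) (fun p => railEdgesN K p.1 p.2.1 p.2.2 r) := by
  have hb : CodeFP (pairE natE n2E) natE (fun p => p.1 + r * K) := natAdd.comp ((fst _ _).pair (const _ (r * K)))
  have h0 : CodeFP (pairE natE n2E) n2E (fun p => (p.2.1, p.1 + r * K)) := (snd _ _).fst'.pair hb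
  have hb' : CodeFP (pairE (pairE natE n2E) natE) natE (fun q => q.1.1 + r * K) := hb.comp (fst _ _)
  have hg : CodeFP (pairE (pairE natE n2E) natE) n2E (fun q => (q.1.1 + r * K + q.2, q.1.1 + r * K + (q.2 + 1))) :=
    (natAdd.comp (hb'.pair (snd _ _))).pair (natAdd.comp (hb'.pair (natAdd.comp ((snd _ _).pair (const _ 1)))))
  have hm : CodeFP (pairE (pairE natE n2E) (rawE natE)) (rawE n2E)
      (fun q => q.2.map fun i => (q.1.1 + r * K + i, q.1.1 + r * K + (i + 1))) := map hg
  have h1 : CodeFP (pairE natE n2E) (rawE n2E) (fun p => (List.range (K - 1)).map fun i => (p.1 + r * K + i, p.1 + r * K + (i + 1))) :=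
    (hm.comp ((CodeFP.id _).pair (const _ (List.range (K - 1))))).congr fun _ => rfl
  have h2 : CodeFP (pairE natE n2E) (rawE n2E) (fun p => [(p.2.2, p.1 + r * K + (K - 1))]) :=
    (rawSingleton n2E).comp ((snd _ _).snd'.pair (natAdd.comp (hb.pair (const _ (K - 1)))))
  have h := (rawCons n2E).comp (h0.pair ((rawAppend n2E).comp (h1.pair h2)))
  exact h.congr fun p => by unfold railEdgesN; rfl

/-- The edges of a placed XOR-chord, with the rails unrolled. [folklore] -/
def xorEdgesL (base : ℕ) (s₀ s₁ : ℕ × ℕ) : List (ℕ × ℕ) :=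
  railEdgesN 4 base s₀.1 s₀.2 0 ++ railEdgesN 4 base s₁.1 s₁.2 1 ++
    (List.range 4).flatMap fun ρ => [(base + (2 * 4 + ρ), base + ρ), (base + (2 * 4 + ρ), base + (4 + ρ))]

/-- `xorEdgesN` unrolled. [folklore] -/
theorem xorEdgesN_eq_L (base : ℕ) (s₀ s₁ : ℕ × ℕ) : xorEdgesN base s₀ s₁ = xorEdgesL base s₀ s₁ := by
  unfold xorEdgesN rpEdgesN xorEdgesL
  simp [List.range_succ]

/-- The edges of a placed one-input OR-gadget, unrolled. [folklore] -/
def or1EdgesL (base : ℕ) (s : ℕ × ℕ) : List (ℕ × ℕ) :=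
  railEdgesN 2 base s.1 s.2 0 ++ [(base + (1 * 2 + 0), base + 0), (base + (1 * 2 + 0), base + 1)]

/-- `or1EdgesN` unrolled. [folklore] -/
theorem or1EdgesN_eq_L (base : ℕ) (s : ℕ × ℕ) : or1EdgesN base s = or1EdgesL base s := by
  unfold or1EdgesN rpEdgesN or1EdgesL
  simp [List.range_succ]

/-- The edges of a placed three-input OR-gadget, unrolled. [folklore] -/
def or3EdgesL (base : ℕ) (s₀ s₁ s₂ : ℕ × ℕ) : List (ℕ × ℕ) :=
  railEdgesN 6 base s₀.1 s₀.2 0 ++ railEdgesN 6 base s₁.1 s₁.2 1 ++ railEdgesN 6 base s₂.1 s₂.2 2 ++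
    (List.range 9).flatMap fun ρ => [(base + (3 * 6 + ρ), base + or3FstC ρ), (base + (3 * 6 + ρ), base + or3SndC ρ)]

/-- `or3EdgesN` unrolled. [folklore] -/
theorem or3EdgesN_eq_L (base : ℕ) (s₀ s₁ s₂ : ℕ × ℕ) : or3EdgesN base s₀ s₁ s₂ = or3EdgesL base s₀ s₁ s₂ := by
  unfold or3EdgesN rpEdgesN or3EdgesL
  simp [List.range_succ]

/-- The XOR edge list is typed polynomial time (context `(base, s₀, s₁)`). [cite: AroraBarak2009, §1.3] -/
theorem codeFP_xorEdgesL : CodeFP (pairE natE (pairE n2E n2E)) (rawE n2E) (fun p => xorEdgesL p.1 p.2.1 p.2.2) := by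
  have hπ0 : CodeFP (pairE natE (pairE n2E n2E)) (pairE natE n2E) (fun p => (p.1, p.2.1)) := (fst _ _).pair (snd _ _).fst'
  have hπ1 : CodeFP (pairE natE (pairE n2E n2E)) (pairE natE n2E) (fun p => (p.1, p.2.2)) := (fst _ _).pair (snd _ _).snd'
  have hr0 := (codeFP_railEdgesN 4 0).comp hπ0
  have hr1 := (codeFP_railEdgesN 4 1).comp hπ1
  have hb : CodeFP (pairE (pairE natE (pairE n2E n2E)) natE) natE (fun q => q.1.1) := (fst _ _).fst'
  have hρ : CodeFP (pairE (pairE natE (pairE n2E n2E)) natE) natE (fun q => q.2) := snd _ _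
  have hm : CodeFP (pairE (pairE natE (pairE n2E n2E)) natE) natE (fun q => q.1.1 + (2 * 4 + q.2)) :=
    natAdd.comp (hb.pair (natAdd.comp ((const _ (2 * 4)).pair hρ)))
  have e1 : CodeFP (pairE (pairE natE (pairE n2E n2E)) natE) n2E (fun q => (q.1.1 + (2 * 4 + q.2), q.1.1 + q.2)) :=
    hm.pair (natAdd.comp (hb.pair hρ))
  have e2 : CodeFP (pairE (pairE natE (pairE n2E n2E)) natE) n2E (fun q => (q.1.1 + (2 * 4 + q.2), q.1.1 + (4 + q.2))) :=
    hm.pair (natAdd.comp (hb.pair (natAdd.comp ((const _ 4).pair hρ))))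
  have hg := (rawCons n2E).comp (e1.pair ((rawSingleton n2E).comp e2))
  have hm' := map hg
  have hc : CodeFP (pairE natE (pairE n2E n2E)) (pairE (pairE natE (pairE n2E n2E)) (rawE natE)) (fun p => (p, List.range 4)) :=
    (CodeFP.id _).pair (const _ (List.range 4))
  have h2 := (flatten n2E).comp (hm'.comp hc)
  have h := (rawAppend n2E).comp (((rawAppend n2E).comp (hr0.pair hr1)).pair h2)
  exact h.congr fun p => by simp only [xorEdgesL, List.flatMap_def]

/-- The one-input OR edge list is typed polynomial time (context `(base, s)`). [cite: AroraBarak2009, §1.3] -/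
theorem codeFP_or1EdgesL : CodeFP (pairE natE n2E) (rawE n2E) (fun p => or1EdgesL p.1 p.2) := by
  have hr0 := codeFP_railEdgesN 2 0
  have hm : CodeFP (pairE natE n2E) natE (fun p => p.1 + (1 * 2 + 0)) := natAdd.comp ((fst _ _).pair (const _ _))
  have e1 : CodeFP (pairE natE n2E) n2E (fun p => (p.1 + (1 * 2 + 0), p.1 + 0)) := hm.pair (natAdd.comp ((fst _ _).pair (const _ 0)))
  have e2 : CodeFP (pairE natE n2E) n2E (fun p => (p.1 + (1 * 2 + 0), p.1 + 1)) := hm.pair (natAdd.comp ((fst _ _).pair (const _ 1)))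
  have h := (rawAppend n2E).comp (hr0.pair ((rawCons n2E).comp (e1.pair ((rawSingleton n2E).comp e2))))
  exact h.congr fun p => rfl

/-- The rung tables of the three-input OR-gadget are typed polynomial time. [cite: AroraBarak2009, §1.3] -/
theorem codeFP_or3C : CodeFP natE natE or3FstC ∧ CodeFP natE natE or3SndC :=
  ⟨((rawGetD natE (d := 0) rfl).comp ((const _ [1, 7, 13, 0, 2, 3, 4, 9, 10]).pair (CodeFP.id natE))).congr fun _ => rfl,
   ((rawGetD natE (d := 0) rfl).comp ((const _ [5, 11, 17, 16, 15, 8, 6, 14, 12]).pair (CodeFP.id natE))).congr fun _ => rfl⟩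

/-- The three-input OR edge list is typed polynomial time (context `(base, s₀, s₁, s₂)`). [cite: AroraBarak2009, §1.3] -/
theorem codeFP_or3EdgesL :
    CodeFP (pairE natE (pairE n2E (pairE n2E n2E))) (rawE n2E) (fun p => or3EdgesL p.1 p.2.1 p.2.2.1 p.2.2.2) := by
  have hπ0 : CodeFP (pairE natE (pairE n2E (pairE n2E n2E))) (pairE natE n2E) (fun p => (p.1, p.2.1)) := (fst _ _).pair (snd _ _).fst'
  have hπ1 : CodeFP (pairE natE (pairE n2E (pairE n2E n2E))) (pairE natE n2E) (fun p => (p.1, p.2.2.1)) :=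
    (fst _ _).pair (snd _ _).snd'.fst'
  have hπ2 : CodeFP (pairE natE (pairE n2E (pairE n2E n2E))) (pairE natE n2E) (fun p => (p.1, p.2.2.2)) :=
    (fst _ _).pair (snd _ _).snd'.snd'
  have hr0 := (codeFP_railEdgesN 6 0).comp hπ0
  have hr1 := (codeFP_railEdgesN 6 1).comp hπ1
  have hr2 := (codeFP_railEdgesN 6 2).comp hπ2
  have hb : CodeFP (pairE (pairE natE (pairE n2E (pairE n2E n2E))) natE) natE (fun q => q.1.1) := (fst _ _).fst'
  have hρ : CodeFP (pairE (pairE natE (pairE n2E (pairE n2E n2E))) natE) natE (fun q => q.2) := snd _ _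
  have hm : CodeFP (pairE (pairE natE (pairE n2E (pairE n2E n2E))) natE) natE (fun q => q.1.1 + (3 * 6 + q.2)) :=
    natAdd.comp (hb.pair (natAdd.comp ((const _ (3 * 6)).pair hρ)))
  have e1 : CodeFP (pairE (pairE natE (pairE n2E (pairE n2E n2E))) natE) n2E (fun q => (q.1.1 + (3 * 6 + q.2), q.1.1 + or3FstC q.2)) :=
    hm.pair (natAdd.comp (hb.pair (codeFP_or3C.1.comp hρ)))
  have e2 : CodeFP (pairE (pairE natE (pairE n2E (pairE n2E n2E))) natE) n2E (fun q => (q.1.1 + (3 * 6 + q.2), q.1.1 + or3SndC q.2)) :=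
    hm.pair (natAdd.comp (hb.pair (codeFP_or3C.2.comp hρ)))
  have hg := (rawCons n2E).comp (e1.pair ((rawSingleton n2E).comp e2))
  have hm' := map hg
  have hc : CodeFP (pairE natE (pairE n2E (pairE n2E n2E))) (pairE (pairE natE (pairE n2E (pairE n2E n2E))) (rawE natE))
      (fun p => (p, List.range 9)) := (CodeFP.id _).pair (const _ (List.range 9))
  have h3 := (flatten n2E).comp (hm'.comp hc)
  have h := (rawAppend n2E).comp (((rawAppend n2E).comp (((rawAppend n2E).comp (hr0.pair hr1)).pair hr2)).pair h3)
  exact h.congr fun p => by simp only [or3EdgesL, List.flatMap_def]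

end Rails

/-! ### The gadgets' lists, numerically -/

section Gadgets

/-- A 5-tuple of numbers. -/
local notation "T5" => ℕ × ℕ × ℕ × ℕ × ℕ

/-- Its code. -/
local notation "t5E" => pairE natE (pairE natE (pairE natE (pairE natE natE)))

/-- The global slot of cell `k` with slot number `s`. [folklore] -/
def gsN (k s : ℕ) : ℕ × ℕ := (17 * k + 1 + s / 16, 17 * k + 1 + s % 16)

/-- Slot numbers decode to the slot's ends. [folklore] -/
theorem slotN_div_mod (e : Fin 16 × Fin 16) : slotN e / 16 = e.1.val ∧ slotN e % 16 = e.2.val := by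
  unfold slotN; have := e.2.isLt; constructor <;> omega

/-- `gs` through slot numbers. [folklore] -/
theorem gs_eq_gsN (k : ℕ) (e : Fin 16 × Fin 16) : gs k e = gsN k (slotN e) := by
  obtain ⟨h1, h2⟩ := slotN_div_mod e
  simp only [gs, gsN, GridCell.vtx, h1, h2]

/-- **The guard of a gadget tuple** (`SpecOK`, numerically; `nc = ncells`). [folklore] -/
def specOKN (nc : ℕ) (t : T5) : Bool :=
  if decide (t.1 = 0) then decide (t.2.1 < nc) && decide (t.2.2.2.1 < nc) && !decide (t.2.1 = t.2.2.2.1) &&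
    !decide (t.2.2.1 / 16 = t.2.2.1 % 16) && !decide (t.2.2.2.2 / 16 = t.2.2.2.2 % 16)
  else if decide (t.1 = 1) then decide (t.2.1 < nc) else if decide (t.1 = 2) then decide (t.2.1 + 2 < nc) else false

/-- The number of inner vertices, by tuple kind. [folklore] -/
def sizeN (c : ℕ) : ℕ := if decide (c = 0) then 12 else if decide (c = 1) then 3 else if decide (c = 2) then 27 else 0

/-- The slots of a gadget tuple. [folklore] -/
def specSlotsN (t : T5) : List (ℕ × ℕ) :=
  if decide (t.1 = 0) then [gsN t.2.1 t.2.2.1, gsN t.2.2.2.1 t.2.2.2.2]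
  else if decide (t.1 = 1) then [gsN t.2.1 (slotN bS0)]
  else if decide (t.1 = 2) then [gsN t.2.1 (slotN bS0), gsN (t.2.1 + 1) (slotN bS0), gsN (t.2.1 + 2) (slotN bS0)] else []

/-- The edges of a gadget tuple placed from `base`. [folklore] -/
def specEdgesN (base : ℕ) (t : T5) : List (ℕ × ℕ) :=
  if decide (t.1 = 0) then xorEdgesL base (gsN t.2.1 t.2.2.1) (gsN t.2.2.2.1 t.2.2.2.2)
  else if decide (t.1 = 1) then or1EdgesL base (gsN t.2.1 (slotN bS0))
  else if decide (t.1 = 2) then or3EdgesL base (gsN t.2.1 (slotN bS0)) (gsN (t.2.1 + 1) (slotN bS0)) (gsN (t.2.1 + 2) (slotN bS0)) else []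

variable (ψ : CNF ℕ)

/-- The guard agrees with `SpecOK`. [folklore] -/
theorem specOKN_specN (s : GadSpec) : specOKN (ncells ψ) (specN s) = decide (SpecOK ψ s) := by
  cases s with
  | xor k₁ e₁ k₂ e₂ =>
    obtain ⟨h1, h2⟩ := slotN_div_mod e₁
    obtain ⟨h3, h4⟩ := slotN_div_mod e₂
    simp only [specOKN, specN, h1, h2, h3, h4, SpecOK, Fin.val_inj]
    by_cases a : k₁ < ncells ψ <;> by_cases b : k₂ < ncells ψ <;> by_cases c : k₁ = k₂ <;> by_cases d : e₁.1 = e₁.2 <;>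
      by_cases e : e₂.1 = e₂.2 <;> simp [a, b, c, d, e]
  | or1 k => simp [specOKN, specN, SpecOK]
  | or3 k => simp [specOKN, specN, SpecOK]

/-- **The vertex block of gadget `g`, numerically.** [folklore] -/
def placeVertsN (g : ℕ) : List ℕ :=
  if specOKN (ncells ψ) (gadN' ψ g) then (List.range (sizeN (gadN' ψ g).1)).map (fun i => gbase ψ g + i) else []

/-- **The slots of gadget `g`, numerically.** [folklore] -/
def placeSlotsN (g : ℕ) : List (ℕ × ℕ) := if specOKN (ncells ψ) (gadN' ψ g) then specSlotsN (gadN' ψ g) else []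

/-- **The edges of gadget `g`, numerically.** [folklore] -/
def placeEdgesN (g : ℕ) : List (ℕ × ℕ) := if specOKN (ncells ψ) (gadN' ψ g) then specEdgesN (gbase ψ g) (gadN' ψ g) else []

/-- `placeVerts = placeVertsN`. [folklore] -/
theorem placeVerts_eqN (g : ℕ) : placeVerts ψ g = placeVertsN ψ g := by
  rw [placeVerts_eq, placeVertsN, ← gadN_gad]
  cases hg : gad ψ g with
  | none => simp [gadN, noneN, specOKN]
  | some s =>
    simp only [Option.elim_some, gadN, specOKN_specN]
    by_cases hok : SpecOK ψ s
    · rw [if_pos hok, if_pos (decide_eq_true hok)]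
      cases s <;> rfl
    · rw [if_neg hok, if_neg (by simp [hok])]

/-- `placeSlots = placeSlotsN`. [folklore] -/
theorem placeSlots_eqN (g : ℕ) : placeSlots ψ g = placeSlotsN ψ g := by
  rw [placeSlots_eq, placeSlotsN, ← gadN_gad]
  cases hg : gad ψ g with
  | none => simp [gadN, noneN, specOKN]
  | some s =>
    simp only [Option.elim_some, gadN, specOKN_specN]
    by_cases hok : SpecOK ψ s
    · rw [if_pos hok, if_pos (decide_eq_true hok)]
      cases s <;> simp [specSlots, specSlotsN, specN, gs_eq_gsN]
    · rw [if_neg hok, if_neg (by simp [hok])]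

/-- `placeEdges = placeEdgesN`. [folklore] -/
theorem placeEdges_eqN (g : ℕ) : placeEdges ψ g = placeEdgesN ψ g := by
  rw [placeEdges_eq, placeEdgesN, ← gadN_gad]
  cases hg : gad ψ g with
  | none => simp [gadN, noneN, specOKN]
  | some s =>
    simp only [Option.elim_some, gadN, specOKN_specN]
    by_cases hok : SpecOK ψ s
    · rw [if_pos hok, if_pos (decide_eq_true hok)]
      cases s <;> simp [specEdges, specEdgesN, specN, gs_eq_gsN, xorEdgesN_eq_L, or1EdgesN_eq_L, or3EdgesN_eq_L]
    · rw [if_neg hok, if_neg (by simp [hok])]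

/-- `placeVerts = placeVertsN`, as functions. [folklore] -/
theorem placeVerts_eqN' : placeVerts ψ = placeVertsN ψ := funext (placeVerts_eqN ψ)

/-- `placeSlots = placeSlotsN`, as functions. [folklore] -/
theorem placeSlots_eqN' : placeSlots ψ = placeSlotsN ψ := funext (placeSlots_eqN ψ)

/-- `placeEdges = placeEdgesN`, as functions. [folklore] -/
theorem placeEdges_eqN' : placeEdges ψ = placeEdgesN ψ := funext (placeEdges_eqN ψ)

/-! #### Typed polynomial time -/

/-- `gsN` is typed polynomial time. [cite: AroraBarak2009, §1.3] -/
theorem codeFP_gsN : CodeFP n2E n2E (fun p => gsN p.1 p.2) := by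
  have hb : CodeFP n2E natE (fun p => 17 * p.1 + 1) := natAdd.comp ((natMul.comp ((const _ 17).pair (fst _ _))).pair (const _ 1))
  have h1 : CodeFP n2E natE (fun p => p.2 / 16) := natDiv.comp ((snd _ _).pair (const _ 16))
  have h2 : CodeFP n2E natE (fun p => p.2 % 16) := natMod.comp ((snd _ _).pair (const _ 16))
  exact ((natAdd.comp (hb.pair h1)).pair (natAdd.comp (hb.pair h2))).congr fun _ => rfl

attribute [local irreducible] gsN xorEdgesL or1EdgesL or3EdgesL

/-- The guard is typed polynomial time (context `(nc, t)`). [cite: AroraBarak2009, §1.3] -/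
theorem codeFP_specOKN : CodeFP (pairE natE t5E) bitE (fun p => specOKN p.1 p.2) := by
  have hnc : CodeFP (pairE natE t5E) natE (fun p => p.1) := fst _ _
  have hc : CodeFP (pairE natE t5E) natE (fun p => p.2.1) := (snd _ _).fst'
  have hk₁ : CodeFP (pairE natE t5E) natE (fun p => p.2.2.1) := (snd _ _).snd'.fst'
  have hs₁ : CodeFP (pairE natE t5E) natE (fun p => p.2.2.2.1) := (snd _ _).snd'.snd'.fst'
  have hk₂ : CodeFP (pairE natE t5E) natE (fun p => p.2.2.2.2.1) := (snd _ _).snd'.snd'.snd'.fst'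
  have hs₂ : CodeFP (pairE natE t5E) natE (fun p => p.2.2.2.2.2) := (snd _ _).snd'.snd'.snd'.snd'
  have t0 : CodeFP (pairE natE t5E) bitE (fun p => decide (p.2.1 = 0)) := natEq.comp (hc.pair (const _ 0))
  have t1 : CodeFP (pairE natE t5E) bitE (fun p => decide (p.2.1 = 1)) := natEq.comp (hc.pair (const _ 1))
  have t2 : CodeFP (pairE natE t5E) bitE (fun p => decide (p.2.1 = 2)) := natEq.comp (hc.pair (const _ 2))
  have a1 : CodeFP (pairE natE t5E) bitE (fun p => decide (p.2.2.1 < p.1)) := natLt.comp (hk₁.pair hnc)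
  have a2 : CodeFP (pairE natE t5E) bitE (fun p => decide (p.2.2.2.2.1 < p.1)) := natLt.comp (hk₂.pair hnc)
  have a3 : CodeFP (pairE natE t5E) bitE (fun p => !decide (p.2.2.1 = p.2.2.2.2.1)) := (natEq.comp (hk₁.pair hk₂)).not
  have dm : ∀ {f : ℕ × T5 → ℕ}, CodeFP (pairE natE t5E) natE f → CodeFP (pairE natE t5E) bitE (fun p => !decide (f p / 16 = f p % 16)) :=
    fun hf => (natEq.comp ((natDiv.comp (hf.pair (const _ 16))).pair (natMod.comp (hf.pair (const _ 16))))).not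
  have x : CodeFP (pairE natE t5E) bitE (fun p => decide (p.2.2.1 < p.1) && decide (p.2.2.2.2.1 < p.1) && !decide (p.2.2.1 = p.2.2.2.2.1) &&
      !decide (p.2.2.2.1 / 16 = p.2.2.2.1 % 16) && !decide (p.2.2.2.2.2 / 16 = p.2.2.2.2.2 % 16)) :=
    (((a1.and a2).and a3).and (dm hs₁)).and (dm hs₂)
  have o3 : CodeFP (pairE natE t5E) bitE (fun p => decide (p.2.2.1 + 2 < p.1)) := natLt.comp ((natAdd.comp (hk₁.pair (const _ 2))).pair hnc)
  exact (t0.ite x (t1.ite a1 (t2.ite o3 (const _ false)))).congr fun p => rfl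

/-- The size table is typed polynomial time. [cite: AroraBarak2009, §1.3] -/
theorem codeFP_sizeN : CodeFP natE natE sizeN :=
  ((natEq.comp ((CodeFP.id natE).pair (const _ 0))).ite (const _ 12) ((natEq.comp ((CodeFP.id natE).pair (const _ 1))).ite (const _ 3)
    ((natEq.comp ((CodeFP.id natE).pair (const _ 2))).ite (const _ 27) (const _ 0)))).congr fun _ => rfl

/-- The slot list of a tuple is typed polynomial time. [cite: AroraBarak2009, §1.3] -/
theorem codeFP_specSlotsN : CodeFP t5E (rawE n2E) specSlotsN := by
  have hc : CodeFP t5E natE (fun t => t.1) := fst _ _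
  have hk₁ : CodeFP t5E natE (fun t => t.2.1) := (snd _ _).fst'
  have hs₁ : CodeFP t5E natE (fun t => t.2.2.1) := (snd _ _).snd'.fst'
  have hk₂ : CodeFP t5E natE (fun t => t.2.2.2.1) := (snd _ _).snd'.snd'.fst'
  have hs₂ : CodeFP t5E natE (fun t => t.2.2.2.2) := (snd _ _).snd'.snd'.snd'
  have g1 := codeFP_gsN.comp (hk₁.pair hs₁)
  have g2 := codeFP_gsN.comp (hk₂.pair hs₂)
  have b0 := codeFP_gsN.comp (hk₁.pair (const _ (slotN bS0)))
  have b1 := codeFP_gsN.comp ((natAdd.comp (hk₁.pair (const _ 1))).pair (const _ (slotN bS0)))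
  have b2 := codeFP_gsN.comp ((natAdd.comp (hk₁.pair (const _ 2))).pair (const _ (slotN bS0)))
  have l0 := (rawCons n2E).comp (g1.pair ((rawSingleton n2E).comp g2))
  have l1 := (rawSingleton n2E).comp b0
  have l2 := (rawCons n2E).comp (b0.pair ((rawCons n2E).comp (b1.pair ((rawSingleton n2E).comp b2))))
  have t0 := natEq.comp (hc.pair (const _ 0))
  have t1 := natEq.comp (hc.pair (const _ 1))
  have t2 := natEq.comp (hc.pair (const _ 2))
  have h := t0.ite l0 (t1.ite l1 (t2.ite l2 (const _ [])))
  exact h.congr fun t => rfl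

/-- The edge list of a placed tuple is typed polynomial time (context `(base, t)`). [cite: AroraBarak2009, §1.3] -/
theorem codeFP_specEdgesN : CodeFP (pairE natE t5E) (rawE n2E) (fun p => specEdgesN p.1 p.2) := by
  have hb : CodeFP (pairE natE t5E) natE (fun p => p.1) := fst _ _
  have hc : CodeFP (pairE natE t5E) natE (fun p => p.2.1) := (snd _ _).fst'
  have hk₁ : CodeFP (pairE natE t5E) natE (fun p => p.2.2.1) := (snd _ _).snd'.fst'
  have hs₁ : CodeFP (pairE natE t5E) natE (fun p => p.2.2.2.1) := (snd _ _).snd'.snd'.fst'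
  have hk₂ : CodeFP (pairE natE t5E) natE (fun p => p.2.2.2.2.1) := (snd _ _).snd'.snd'.snd'.fst'
  have hs₂ : CodeFP (pairE natE t5E) natE (fun p => p.2.2.2.2.2) := (snd _ _).snd'.snd'.snd'.snd'
  have g1 := codeFP_gsN.comp (hk₁.pair hs₁)
  have g2 := codeFP_gsN.comp (hk₂.pair hs₂)
  have b0 := codeFP_gsN.comp (hk₁.pair (const _ (slotN bS0)))
  have b1 := codeFP_gsN.comp ((natAdd.comp (hk₁.pair (const _ 1))).pair (const _ (slotN bS0)))
  have b2 := codeFP_gsN.comp ((natAdd.comp (hk₁.pair (const _ 2))).pair (const _ (slotN bS0)))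
  have lx := codeFP_xorEdgesL.comp (hb.pair (g1.pair g2))
  have l1 := codeFP_or1EdgesL.comp (hb.pair b0)
  have l3 := codeFP_or3EdgesL.comp (hb.pair (b0.pair (b1.pair b2)))
  have t0 := natEq.comp (hc.pair (const _ 0))
  have t1 := natEq.comp (hc.pair (const _ 1))
  have t2 := natEq.comp (hc.pair (const _ 2))
  have h := t0.ite lx (t1.ite l1 (t2.ite l3 (const _ [])))
  exact h.congr fun p => rfl

/-- Context `(ψ, g)`. -/
local notation "E2" => pairE cnfC natE

/-- The guard of gadget `g`, in context. [cite: AroraBarak2009, §1.3] -/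
theorem codeFP_okG : CodeFP E2 bitE (fun p => specOKN (ncells p.1) (gadN' p.1 p.2)) :=
  codeFP_specOKN.comp ((codeFP_ncells.comp (fst _ _)).pair codeFP_gadN')

/-- `gbase ψ g`, in context. [cite: AroraBarak2009, §1.3] -/
theorem codeFP_gbase : CodeFP E2 natE (fun p => gbase p.1 p.2) :=
  (natAdd.comp ((natMul.comp ((const _ 17).pair (codeFP_ncells.comp (fst _ _)))).pair (natMul.comp ((const _ 64).pair (snd _ _))))).congr
    fun p => by unfold gbase; rfl

/-- **The vertex block of gadget `g` is typed polynomial time.** [cite: AroraBarak2009, §1.3] -/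
theorem codeFP_placeVertsN : CodeFP E2 (rawE natE) (fun p => placeVertsN p.1 p.2) := by
  have h27 := rangeOf.comp ((const E2 27).pair (codeFP_sizeN.comp codeFP_gadN'.fst'))
  have hsz : CodeFP E2 (rawE natE) (fun p => List.range (sizeN (gadN' p.1 p.2).1)) := by
    refine h27.congr fun p => ?_
    show List.range (min (sizeN (gadN' p.1 p.2).1) 27) = _
    rw [min_eq_left]; unfold sizeN; split_ifs <;> omega
  have hbq : CodeFP (pairE E2 natE) natE (fun q => gbase q.1.1 q.1.2) := codeFP_gbase.comp (fst _ _)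
  have hg := natAdd.comp (hbq.pair (snd _ _))
  have hm := map hg
  have hl := hm.comp ((CodeFP.id E2).pair hsz)
  have h := codeFP_okG.ite hl (const _ [])
  exact h.congr fun p => by simp only [placeVertsN, id]

/-- **The slots of gadget `g` are typed polynomial time.** [cite: AroraBarak2009, §1.3] -/
theorem codeFP_placeSlotsN : CodeFP E2 (rawE n2E) (fun p => placeSlotsN p.1 p.2) :=
  (codeFP_okG.ite (codeFP_specSlotsN.comp codeFP_gadN') (const _ [])).congr fun p => by simp only [placeSlotsN]

/-- **The edges of gadget `g` are typed polynomial time.** [cite: AroraBarak2009, §1.3] -/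
theorem codeFP_placeEdgesN : CodeFP E2 (rawE n2E) (fun p => placeEdgesN p.1 p.2) :=
  (codeFP_okG.ite (codeFP_specEdgesN.comp (codeFP_gbase.pair codeFP_gadN')) (const _ [])).congr fun p => by simp only [placeEdgesN]

attribute [local irreducible] specOKN specSlotsN specEdgesN placeVertsN placeSlotsN placeEdgesN

end Gadgets

/-! ### The whole graph -/

section Whole

/-- **The number of gadgets, in unary** (the budget of the gadget ranges). [cite: AroraBarak2009, §1.3] -/
theorem codeFP_ungadgets : CodeFP cnfC unE ngadgets := by
  have h8 : CodeFP cnfC unE (fun ψ => 8 * (V ψ * N ψ)) :=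
    (unAdd.comp ((unAdd.comp ((unAdd.comp (codeFP_uVN.pair codeFP_uVN)).pair (unAdd.comp (codeFP_uVN.pair codeFP_uVN)))).pair
      (unAdd.comp ((unAdd.comp (codeFP_uVN.pair codeFP_uVN)).pair (unAdd.comp (codeFP_uVN.pair codeFP_uVN)))))).congr fun ψ => by ring
  have hl : CodeFP cnfC unE (fun ψ : CNF ℕ => ψ.length) := (ulength clauseC).comp (rawOfList clauseC)
  exact (unAdd.comp ((unAdd.comp (h8.pair codeFP_uN)).pair hl)).congr fun ψ => by unfold ngadgets; rfl

/-- The gadget range. [cite: AroraBarak2009, §1.3] -/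
theorem codeFP_gadRange : CodeFP cnfC (rawE natE) (fun ψ => List.range (ngadgets ψ)) := (urange.comp codeFP_ungadgets).congr fun _ => rfl

/-- **The vertex list of `graphOf ψ` is typed polynomial time.** [cite: AroraBarak2009, §1.3] -/
theorem codeFP_vertsListOf : CodeFP cnfC (rawE natE) vertsListOf := by
  have hm := (map (σ := CNF ℕ) (eσ := cnfC) codeFP_placeVertsN).comp ((CodeFP.id cnfC).pair codeFP_gadRange)
  have hg := (flatten natE).comp hm
  exact ((rawAppend natE).comp (codeFP_chainVertsN.pair hg)).congr fun ψ => by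
    simp only [vertsListOf, List.flatMap_def, id, placeVerts_eqN']

/-- **The slot list of `graphOf ψ` is typed polynomial time.** [cite: AroraBarak2009, §1.3] -/
theorem codeFP_slotsOf : CodeFP cnfC (rawE n2E) slotsOf := by
  have hm := (map (σ := CNF ℕ) (eσ := cnfC) codeFP_placeSlotsN).comp ((CodeFP.id cnfC).pair codeFP_gadRange)
  exact ((flatten n2E).comp hm).congr fun ψ => by
    simp only [slotsOf, List.flatMap_def, id, placeSlots_eqN']

/-- The gadget part of the edge list. [cite: AroraBarak2009, §1.3] -/
theorem codeFP_gadgetEdges : CodeFP cnfC (rawE n2E) (fun ψ => (List.range (ngadgets ψ)).flatMap (placeEdges ψ)) := by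
  have hm := (map (σ := CNF ℕ) (eσ := cnfC) codeFP_placeEdgesN).comp ((CodeFP.id cnfC).pair codeFP_gadRange)
  exact ((flatten n2E).comp hm).congr fun ψ => by
    simp only [List.flatMap_def, id, placeEdges_eqN']

/-- **The edge list of `graphOf ψ` is typed polynomial time.** [cite: AroraBarak2009, §1.3] -/
theorem codeFP_edgesOf : CodeFP cnfC (rawE n2E) edgesOf := by
  -- the filter: not a slot in either orientation (context: the slot list)
  have hmem := mem (α := ℕ × ℕ) n2E_injective
  have he : CodeFP (pairE (rawE n2E) n2E) n2E (fun q => q.2) := snd _ _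
  have hsw : CodeFP (pairE (rawE n2E) n2E) n2E (fun q => q.2.swap) := (he.snd'.pair he.fst').congr fun _ => rfl
  have hS : CodeFP (pairE (rawE n2E) n2E) (rawE n2E) (fun q => q.1) := fst _ _
  have hp : CodeFP (pairE (rawE n2E) n2E) bitE (fun q => !decide (q.2 ∈ q.1) && !decide (q.2.swap ∈ q.1)) :=
    (hmem.comp (he.pair hS)).not.and (hmem.comp (hsw.pair hS)).not
  have hf := filter hp
  have hc := hf.comp (codeFP_slotsOf.pair codeFP_chainEdgesN)
  exact ((rawAppend n2E).comp (hc.pair codeFP_gadgetEdges)).congr fun ψ => by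
    unfold edgesOf
    congr 1
    exact List.filter_congr fun e _ => by simp [Bool.decide_and]

end Whole

end GridFormulaFP

end Literature.Barriers.CriticalPhenomena.GridSAW
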